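import Literature.NumberTheory.Automorphic.Sweep1PotentialModularity
import Literature.NumberTheory.EllipticCurves.HasseWeilAbelianUnramifiedProofs
import Literature.NumberTheory.EllipticCurves.TateModuleContinuityProofs
import Literature.NumberTheory.EllipticCurves.TateModuleFinite
import HarnessLib

/-!
# Potential modularity of elliptic curves over CM fields (lang.S28): the reduction of
`Literature.NumberTheory.Automorphic.exists_isCMField_isModular` to two named facts

Pure-proof sibling of `Literature.NumberTheory.Automorphic.Sweep1PotentialModularity` (namespace
`Literature.Lang`), landed by the tenured seat of the named fact `Literature.NumberTheory.Automorphic.exists_isCMField_isModular`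
(**lang.S28**; Allen–Calegari–Caraiani–Gee–Helm–Le Hung–Newton–Scholze–Taylor–Thorne, *Potential
automorphy over CM fields*, Ann. of Math. 197 (2023), Thm. 1.0.1).  The parent file proves
`exists_isCMField_isModular_of_isTateAutomorphic`: the Galois-side statement of the source
(Cor. 7.1.12 for `m = 1` and the compatible system `R_E` of a non-CM elliptic curve: over a finite
Galois CM extension `F'/F`, `E ×_F F'` is Tate-automorphic — an explicit **hypothesis**, the
statement of the former named fact `exists_isCMField_isTateAutomorphic`, merged back into the
obligation `exists_isCMField_isModular` by the review of 2026-08-15, D-0026) implies the `Sweep1`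
transcription `Literature.NumberTheory.Automorphic.exists_isCMField_isModular`, given at one
auxiliary prime `ℓ` four standard facts about the rational Tate module `V_ℓ E` of elliptic curves
over number fields, all of which were named facts (D-0014) when the parent landed.  Three of the
four are now theorems of `Literature`:

* continuity of `Γ_F × V_ℓ E → V_ℓ E` — `WeierstrassCurve.continuous_rationalGaloisRepTate_holds`
  (`TateModuleContinuityProofs`; Serre (1968), Ch. I §1.1–1.2);
* `dim_{ℚ_ℓ} V_ℓ E < ∞` — `WeierstrassCurve.module_finite_rationalTateModule_holds`
  (`TateModuleFinite`; Silverman, *AEC*, III.7.1);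
* `L_v(V_ℓ E, T) = det(1 - Frob_v T | V_ℓ E)` at unramified `v` —
  `Literature.NumberTheory.EllipticCurves.hasseWeilEulerFactor_eq_reverse_frobCharpoly_holds` (`HasseWeilAbelianUnramifiedProofs`;
  Serre (1968), Ch. I §2.1, §2.3),

so this file records the sharper reductions

* `WeierstrassCurve.IsTateAutomorphic.isModular_of_eulerFactor` (**proved**): a Tate-automorphic
  elliptic curve over a number field is modular in the sense of `WeierstrassCurve.IsModular`
  (`Sweep1`), given only the identification of the `ℓ`-adic Euler factors of `V_ℓ E` at `v ∤ ℓ`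
  with Mathlib's local polynomials (`WeierstrassCurve.hasseWeilEulerFactor_geomPoints`;
  Silverman V.2.3.1, VII.4.1, C.§16; Serre–Tate Thm. 3 — the criterion of Néron–Ogg–Shafarevich
  and the trace of Frobenius on `T_ℓ Ẽ`, a named fact of `HasseWeilAbelian`);
* `Literature.NumberTheory.Automorphic.exists_isCMField_isModular_of_isTateAutomorphic_of_eulerFactor` (**proved**):
  the Galois-side statement of the source (hypothesis) and `hasseWeilEulerFactor_geomPoints` (for
  all elliptic curves over number fields, at one prime `ℓ`) imply
  `Literature.NumberTheory.Automorphic.exists_isCMField_isModular`.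

Hence the accepted formulation of lang.S28 in `Sweep1` rests on the source's Cor. 7.1.12 for `R_E`
(the whole of the source; see the parent's module docstring, "Proof architecture" — the obligation
`exists_isCMField_isModular` itself) and one named fact, the Euler factors of the Tate module of
an elliptic curve.

## References

* P. B. Allen, F. Calegari, A. Caraiani, T. Gee, D. Helm, B. V. Le Hung, J. Newton, P. Scholze,
  R. Taylor, J. A. Thorne, *Potential automorphy over CM fields*, Ann. of Math. (2) 197 (2023),
  897–1113: Thm. 1.0.1, §7.1, Cor. 7.1.12. [AllenCalegariCaraianiGeeEtAl2023]
* J. H. Silverman, *The Arithmetic of Elliptic Curves*, 2nd ed., GTM 106 (2009), III.7.1,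
  V.2.3.1, VII.4.1, C.§16. [SilvermanAEC2009]
* J.-P. Serre, *Abelian ℓ-adic representations and elliptic curves* (1968), Ch. I §1.1–1.2,
  §2.1, §2.3. [SerreAbelianLadic1968]
* J.-P. Serre, J. Tate, *Good reduction of abelian varieties*, Ann. of Math. 88 (1968), Thm. 3.
  [SerreTate1968]
-/

namespace Literature.NumberTheory.Automorphic

/-- **From the Galois form to `Sweep1`'s automorphic form, with one standard fact.**  A
Tate-automorphic elliptic curve over a number field is modular in the sense of
`WeierstrassCurve.IsModular`, given at one auxiliary prime `ℓ` the identification of the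
`ℓ`-adic Euler factors `det(1 - σ_v T | (V_ℓ E)_{I_v})`, `v ∤ ℓ`, with Mathlib's local
polynomials (`hasseWeilEulerFactor_geomPoints`; Silverman V.2.3.1, VII.4.1, C.§16; Serre–Tate
Thm. 3).  This is `IsTateAutomorphic.isModular` of the parent file with its three other
hypotheses discharged: continuity of `Γ_F × V_ℓ E → V_ℓ E` by
`continuous_rationalGaloisRepTate_holds` (`TateModuleContinuityProofs`, Serre I.1.1–1.2),
`dim V_ℓ E < ∞` by `module_finite_rationalTateModule_holds` (`TateModuleFinite`, Silverman
III.7.1) and `L_v = det(1 - Frob_v T)` at unramified `v` by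
`hasseWeilEulerFactor_eq_reverse_frobCharpoly_holds` (`HasseWeilAbelianUnramifiedProofs`, Serre
I.2.3).  Silverman, *AEC*, V.2.3.1 and C.§16 (`L_v(E, T) = 1 - a_v T + q_v T²`, `a_v` the trace
of Frobenius). [cite: SilvermanAEC2009, Thm. V.2.3.1 and C.§16] -/
theorem _root_.WeierstrassCurve.IsTateAutomorphic.isModular_of_eulerFactor {F : Type} [Field F]
    [NumberField F] {W : WeierstrassCurve F} [W.IsElliptic] (hW : W.IsTateAutomorphic) (ℓ : ℕ)
    [Fact ℓ.Prime] (h₁ : W.hasseWeilEulerFactor_geomPoints ℓ) : W.IsModular :=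
  hW.isModular ℓ (W.continuous_rationalGaloisRepTate_holds ℓ)
    (W.module_finite_rationalTateModule_holds ℓ) h₁
    (EllipticCurves.hasseWeilEulerFactor_eq_reverse_frobCharpoly_holds (K := F) (WeierstrassCurve.geomPoints W) ℓ)

/-- **lang.S28 (`Sweep1` form) from the Galois form and one standard fact.**  The Galois-side
statement of the source (Allen et al., Cor. 7.1.12 for `R_E`, i.e. Thm. 1.0.1 for a non-CM `E`:
over a finite Galois CM extension `F'/F`, `E ×_F F'` is Tate-automorphic; the explicit hypothesis
`hACC`, formerly the named fact `exists_isCMField_isTateAutomorphic`, merged back 2026-08-15)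
together with the Euler factors of `V_ℓ E` at one prime `ℓ` for all elliptic curves over number
fields (`hasseWeilEulerFactor_geomPoints`) implies
`Literature.NumberTheory.Automorphic.exists_isCMField_isModular`: every elliptic curve without geometric CM over a CM field
becomes modular (`WeierstrassCurve.IsModular`) over a finite CM extension.  This is
`exists_isCMField_isModular_of_isTateAutomorphic` of the parent file with continuity and
finite-dimensionality of `V_ℓ E` and the unramified Euler-factor comparison now proved
(`continuous_rationalGaloisRepTate_holds`, `module_finite_rationalTateModule_holds`,
`hasseWeilEulerFactor_eq_reverse_frobCharpoly_holds`).  So the accepted formulation of lang.S28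
in `Sweep1` rests on the source and one named fact.
[cite: AllenCalegariCaraianiGeeEtAl2023, Thm. 1.0.1 (non-CM case), via Cor. 7.1.12] -/
theorem exists_isCMField_isModular_of_isTateAutomorphic_of_eulerFactor (ℓ : ℕ) [Fact ℓ.Prime]
    (hACC : ∀ {F : Type} [Field F] [NumberField F] [NumberField.IsCMField F]
      (W : WeierstrassCurve F) [W.IsElliptic] (_hW : ¬ W.HasCM),
      ∃ (F' : Type) (_ : Field F') (_ : NumberField F') (_ : Algebra F F'),
        NumberField.IsCMField F' ∧ IsGalois F F' ∧ (W.baseChange F').IsTateAutomorphic)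
    (h₁ : ∀ {K : Type} [Field K] [NumberField K] (W : WeierstrassCurve K) [W.IsElliptic],
      W.hasseWeilEulerFactor_geomPoints ℓ) :
    exists_isCMField_isModular :=
  exists_isCMField_isModular_of_isTateAutomorphic ℓ hACC
    (fun W => W.continuous_rationalGaloisRepTate_holds ℓ)
    (fun W => W.module_finite_rationalTateModule_holds ℓ) h₁
    (fun W => EllipticCurves.hasseWeilEulerFactor_eq_reverse_frobCharpoly_holds (WeierstrassCurve.geomPoints W) ℓ)

end Literature.NumberTheory.Automorphic
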